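import Mathlib.NumberTheory.Chebyshev
import Mathlib.Analysis.Complex.ExponentialBounds
import Literature.NumberTheory.LFunctions.ChebyshevSylvesterPsi
import HarnessLib

/-!
# Costa Pereira's `m = 17` Chebyshev scheme: `0.9636 x ≤ ψ(x)` (`x ≥ 227`) and `ψ(x) ≤ 1.0364 x` (`x ≥ 201`)

Topic `Literature/NumberTheory/LFunctions` (prime distribution, elementary); namespace
`Literature.NumberTheory.LFunctions.CostaPereira`.  Everything here is PROVED (no named facts, no
definitions beyond the scheme's bookkeeping, no instances, no notation).  `ψ`, `θ`, `π` are Mathlib's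
`Chebyshev.psi`, `Chebyshev.theta`, `Nat.primeCounting`.

Source: N. Costa Pereira, *Elementary estimates for the Chebyshev function `ψ(x)` and for the Möbius
function `M(x)`*, Acta Arith. 52 (1989) 307–337 [CostaPereira1989], §2.  With the tree's Sylvester file
(`ChebyshevSylvesterPsi.lean`: scheme `ν₆`, period `210`, `0.9392 x − 9 √x ≤ ψ(x) ≤ 1.0722 x + 7 √x`) this
is the second kernel-certified Chebyshev scheme; its lower constant `0.9636` is the first all-purpose one
above `0.96` in the tree (origin: cell `parity-ideate`, seat p5 g21, ROUND-43 «c₀», pub file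
`round43/CostaPereira17A.lean` sha16 `5d9985509b350c1b`, landed here re-namespaced with statements and proofs
verbatim; it feeds the explicit Shnirel'man–Goldbach chain `ShnirelmanGoldbach*.lean`, where the Chebyshev
lower constant enters the one-shift reach, every shift slope and the first moment of the Goldbach count).

## The scheme and the argument [CostaPereira1989, §2, pp. 313–323]

Costa Pereira's general device (§1, (1.6)–(1.24); §2, (2.1)–(2.4)): for a finitely supported integer-valued
`ν` with `ν = μ` on `[1, m)` and `∑ ν(r)/r = 0`, the sum `σ(x) = ∑_r ν(r) log ⌊x/r⌋!` (here `V`, (2.1))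
equals `∑_{k ≤ x} Λ(k) F(⌊x/k⌋)` with the periodic step function `F(y) = ∑_r ν(r) ⌊y/r⌋` ((1.10)), and
`σ(x) = ω x + O(log x)` with `ω = −∑ ν(r) log r / r` ((2.2)–(2.3), Lemma 3 (2.5)).  Comparing `F` from
above and below with indicator combinations of blocks `[u, v)` and tails `[t, ∞)` gives the two
inequalities (2.13)–(2.14) `ψ(x) ≤ σ(x) + ∑ ψ(x/a_s) − ∑ (ψ(x/b_k) − ψ(x/c_k))`,
`ψ(x) ≥ σ(x) − ∑ ψ(x/a_s) + ∑ (ψ(x/b_k) − ψ(x/c_k))`, and Theorem 2 / Corollary 1 ((2.28)–(2.39)) turn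
them into finite bounds `L⁻ < ψ(x)/x < L⁺` for `x ≥ N` by induction from a verified base range.
The `m = 17` scheme (p. 321): `ν = μ` on `[1,17)`, `ν(182) = 1`, `ν(30) = ν(42) = ν(110) = −1`, i.e.
`∑_{k=1}^{16} μ(k)/k + 1/182 − 1/30 − 1/42 − 1/110 = 0`; `F = F₀ + F₁ + F₂ + F₃` with
`F₀ = [y] + [y/15] − [y/2] − [y/3] − [y/5]`, `F₁ = [y/6] − [y/7] − [y/42]`, `F₂ = [y/10] − [y/11] − [y/110]`,
`F₃ = [y/14] + [y/182] − [y/13]` (p. 321), `−1 ≤ F ≤ 4`, period `30030` (p. 322),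
`ω = 1.04652442…` (p. 323).  PRINTED result for this scheme ((2.41), p. 323, from the table of blocks on
p. 322, `N = 10⁵` and a table of primes to `10⁵`): `ψ(x)/x > 25/26` for `x ≥ 227` and `ψ(x)/x < 27/26`
for `x ≥ 114` (`L⁻ = 0.961776…`, `L⁺ = 1.038383…`).

PROVED HERE (same scheme, same mechanism, a different finite design — so the constants differ from print):
* §1 the scheme and `−1 ≤ F ≤ 4` (`F_range`, by `decide` on the four component periods `30/42/110/182`);
* §2 block-comparison weights frozen at `Z = 2000` (19 blocks + 3 tails below, 10 + 2 + 9 terms above;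
  `F ≤ w_L`, `w_U ≤ F` by `decide +kernel` below `2000`);
* §3 the base range `227 ≤ x ≤ 5·10⁴` by the `lcm(1,…,n)⁴`-against-powers-of-two certificate
  (`Chebyshev.psi_eq_log_lcmUpto`; 10 chunks of 5000, `decide +kernel`);
* §4 `V = ∑ Λ(k) F(⌊N/k⌋)` and the two `ψ`-comparisons ((2.13)–(2.14) for these blocks);
* §5 `|V(⌊x⌋) − ω x| ≤ 15 log x + 30` (`x ≥ 182`; the role of Lemma 3 (2.5), from the tree's weak Stirling
  bound `Sylvester.abs_T_div_sub_le`) and `1.0465243 ≤ ω ≤ 1.0465245`;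
* §6 the base range `5·10⁴ ≤ x ≤ 10⁶` from the tree's kernel `θ`-table (`abs_theta_sub_le_smallRange`)
  and `ψ − θ ≤ √x + (4/3) x^{1/3}` (`psi_sub_theta_le_of_lt_two_pow_32`);
* §7 the induction for `x ≥ 10⁶` (Theorem 2's step with explicit `O(log x)` error) and the public results
  `costaPereira_le_psi : 227 ≤ x → 0.9636 * x ≤ ψ x`, `psi_le_costaPereira : 201 ≤ x → ψ x ≤ 1.0364 * x`,
  `primeCounting_ge : 227 ≤ n → 0.9636 * n / log n ≤ π n`.
The lower constant `0.9636` is STRONGER than the printed `25/26 = 0.96153…` (and than the printed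
`L⁻ = 0.961776…`); the upper constant `1.0364 < 27/26` is stronger but its range starts at `201` instead of
the printed `114`.  Truth on `[227, 10⁶]` (sieve, not used): `min ψ(n)/(n+1) = 0.96764` at `n = 346`
(Costa Pereira's Table I, p. 334: `λ⁻(227) = 0.9676432`, `λ⁺(201) = 1.0272755`).

## What is NOT here

Costa Pereira's `m = 8021` scheme and its consequences ((2.43)–(2.50): `|ψ(x)/x − 1| < 1/531` for
`x ≥ 10⁸`; Theorem 3: `θ(x) < 532x/531` for `x > 0`, `θ(x) > 499x/500` for `x ≥ 487381`) — these rest on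
his machine tables to `10⁸` and are not kernel-feasible in this form; the Möbius-sum estimates of §3
(Theorem 5, `|M(x)| < x/1036` for `x ≥ 120727`); prime-in-short-interval corollaries.

## References

* [CostaPereira1989] N. Costa Pereira, *Elementary estimates for the Chebyshev function ψ(x) and for the
  Möbius function M(x)*, Acta Arith. 52 (1989), no. 4, 307–337, doi:10.4064/aa-52-4-307-337 — §2,
  Theorem 2 (p. 318), Corollary 1 (2.37)–(2.39) (p. 320), the `m = 17` scheme (p. 321), `−1 ≤ F ≤ 4`
  (p. 322), (2.41) (p. 323), Table I (p. 334).  (Page images + transcript: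
  `run/shared/lean/pub/parity-ideate/parity-ideate-lit/renders/paper-costapereira1989-chebyshev-AA52/`.)
-/

open Finset Real
open scoped Chebyshev

namespace Literature.NumberTheory.LFunctions.CostaPereira


/-! ### §1 The scheme `ν₁₇` of Costa Pereira and the range of `F` -/

/-- `F₀(y) = [y] + [y/15] − [y/2] − [y/3] − [y/5]` (period `30`, values `0,1,2`). [cite: CostaPereira1989, p. 321 (the `m = 17` scheme, decomposition `F = F₀+F₁+F₂+F₃`)] -/
def F0 (r : ℕ) : ℤ := (r : ℤ) - (r / 2 : ℕ) - (r / 3 : ℕ) - (r / 5 : ℕ) + (r / 15 : ℕ) - (r / 30 : ℕ)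

/-- `F₁(y) = [y/6] − [y/7] − [y/42]` (period `42`, values `0,1`). [cite: CostaPereira1989, p. 321] -/
def F1 (r : ℕ) : ℤ := ((r / 6 : ℕ) : ℤ) - (r / 7 : ℕ) - (r / 42 : ℕ)

/-- `F₂(y) = [y/10] − [y/11] − [y/110]` (period `110`, values `0,1`). [cite: CostaPereira1989, p. 321] -/
def F2 (r : ℕ) : ℤ := ((r / 10 : ℕ) : ℤ) - (r / 11 : ℕ) - (r / 110 : ℕ)

/-- `F₃(y) = [y/14] + [y/182] − [y/13]` (period `182`, values `−1,0`). [cite: CostaPereira1989, p. 321] -/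
def F3 (r : ℕ) : ℤ := ((r / 14 : ℕ) : ℤ) - (r / 13 : ℕ) + (r / 182 : ℕ)

/-- `F(y) = Σ_k ν(k) ⌊y/k⌋` for Costa Pereira's `m = 17` scheme `ν₁₇` (`ν = μ` on `[1,17)`, `ν(182) = 1`,
`ν(30) = ν(42) = ν(110) = −1`; 15 terms). [cite: CostaPereira1989, (1.10) with the scheme of p. 321] -/
def F (r : ℕ) : ℤ :=
  (r : ℤ) - (r / 2 : ℕ) - (r / 3 : ℕ) - (r / 5 : ℕ) + (r / 6 : ℕ) - (r / 7 : ℕ) + (r / 10 : ℕ)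
    - (r / 11 : ℕ) - (r / 13 : ℕ) + (r / 14 : ℕ) + (r / 15 : ℕ) - (r / 30 : ℕ) - (r / 42 : ℕ)
    - (r / 110 : ℕ) + (r / 182 : ℕ)

/-- `F = F₀ + F₁ + F₂ + F₃`. [cite: CostaPereira1989, p. 321] -/
theorem F_eq (r : ℕ) : F r = F0 r + F1 r + F2 r + F3 r := by
  unfold F F0 F1 F2 F3; ring

/-- `F₀` has period `30`. [folklore] -/
private theorem F0_mod (r : ℕ) : F0 r = F0 (r % 30) := by unfold F0; push_cast; omega
/-- `F₁` has period `42`. [folklore] -/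
private theorem F1_mod (r : ℕ) : F1 r = F1 (r % 42) := by unfold F1; push_cast; omega
/-- `F₂` has period `110`. [folklore] -/
private theorem F2_mod (r : ℕ) : F2 r = F2 (r % 110) := by unfold F2; push_cast; omega
/-- `F₃` has period `182`. [folklore] -/
private theorem F3_mod (r : ℕ) : F3 r = F3 (r % 182) := by unfold F3; push_cast; omega

/-- `0 ≤ F₀ ≤ 2`. [cite: CostaPereira1989, p. 322] -/
private theorem F0_range (r : ℕ) : 0 ≤ F0 r ∧ F0 r ≤ 2 := by
  have h : ∀ s < 30, 0 ≤ F0 s ∧ F0 s ≤ 2 := by decide +kernel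
  rw [F0_mod]; exact h _ (Nat.mod_lt _ (by norm_num))

/-- `0 ≤ F₁ ≤ 1`. [cite: CostaPereira1989, p. 322] -/
private theorem F1_range (r : ℕ) : 0 ≤ F1 r ∧ F1 r ≤ 1 := by
  have h : ∀ s < 42, 0 ≤ F1 s ∧ F1 s ≤ 1 := by decide +kernel
  rw [F1_mod]; exact h _ (Nat.mod_lt _ (by norm_num))

/-- `0 ≤ F₂ ≤ 1`. [cite: CostaPereira1989, p. 322] -/
private theorem F2_range (r : ℕ) : 0 ≤ F2 r ∧ F2 r ≤ 1 := by
  have h : ∀ s < 110, 0 ≤ F2 s ∧ F2 s ≤ 1 := by decide +kernel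
  rw [F2_mod]; exact h _ (Nat.mod_lt _ (by norm_num))

/-- `−1 ≤ F₃ ≤ 0`. [cite: CostaPereira1989, p. 322] -/
private theorem F3_range (r : ℕ) : -1 ≤ F3 r ∧ F3 r ≤ 0 := by
  have h : ∀ s < 182, -1 ≤ F3 s ∧ F3 s ≤ 0 := by decide +kernel
  rw [F3_mod]; exact h _ (Nat.mod_lt _ (by norm_num))

/-- **`−1 ≤ F ≤ 4`** (hence `s⁻ = −1`, `s⁺ = 4`, `w = 1/2`; `F` has period `30030`). [cite: CostaPereira1989, p. 322 (`−1 ≤ F(x) ≤ 4`)] -/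
theorem F_range (r : ℕ) : -1 ≤ F r ∧ F r ≤ 4 := by
  rw [F_eq]
  have h0 := F0_range r; have h1 := F1_range r; have h2 := F2_range r; have h3 := F3_range r
  constructor <;> linarith [h0.1, h0.2, h1.1, h1.2, h2.1, h2.2, h3.1, h3.2]

/-! ### §2 Block comparison weights (design `Z = 2000`) -/

/-- Indicator of the block `u ≤ r < v`. [folklore] -/
private def blk (u v r : ℕ) : ℤ := if u ≤ r ∧ r < v then 1 else 0

/-- Indicator of the tail `t ≤ r`. [folklore] -/
private def tail (t r : ℕ) : ℤ := if t ≤ r then 1 else 0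

/-- Lower-side cost blocks (maximal runs of `F ≥ 2`, `F ≥ 3`, `F = 4` below `2000`; design `Z = 2000` of p5 `design43.py`,
in place of the intervals `[a′_k(s), b′_k(s))` of the table on p. 322). [cite: CostaPereira1989, p. 322 (table) — this file's own design] -/
private def BL : List (ℕ × ℕ) :=
  [(17, 26), (29, 65), (71, 117), (19, 21), (31, 33), (61, 63), (73, 77), (83, 84), (103, 110),
   (193, 208), (229, 242), (271, 294), (323, 325), (373, 440), (493, 504), (571, 660), (713, 770),
   (829, 1974), (439, 440)]

/-- Lower-side tails: `F ≥ 2` on `[139, ∞)` is paid in full, and `F ≤ 4` above `2000` twice. [cite: CostaPereira1989, p. 322 (table) — this file's own design] -/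
private def TL : List ℕ := [139, 2000, 2000]

/-- Upper-side cost blocks (maximal runs of `F ≤ 0` below `2000`). [cite: CostaPereira1989, p. 322 (table) — this file's own design] -/
private def BU : List (ℕ × ℕ) :=
  [(66, 67), (126, 157), (176, 179), (220, 223), (275, 277), (330, 359), (429, 551), (598, 727),
   (806, 1061), (1144, 1997)]

/-- Upper-side tails: `F ≥ −1` above `2000`, paid twice. [cite: CostaPereira1989, p. 322 (table) — this file's own design] -/
private def TU : List ℕ := [2000, 2000]

/-- Upper-side gain blocks (runs of `F ≥ 2`, `F ≥ 3` below `210` credited in the upper bound). [cite: CostaPereira1989, p. 322 (table) — this file's own design] -/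
private def GU : List (ℕ × ℕ) :=
  [(17, 22), (23, 26), (29, 35), (47, 52), (59, 65), (71, 78), (79, 88), (191, 210), (19, 21)]

/-- The lower comparison weight `w_L = 𝟙[1,∞) + Σ_{BL} 𝟙[u,v) + Σ_{TL} 𝟙[t,∞)` (so that `F ≤ w_L`). [cite: CostaPereira1989, (2.11)/(2.13) (block comparison)] -/
private def wL (r : ℕ) : ℤ :=
  tail 1 r + (BL.map fun b => blk b.1 b.2 r).sum + (TL.map fun t => tail t r).sum

/-- The upper comparison weight `w_U = 𝟙[1,∞) − Σ_{BU} 𝟙[u,v) − Σ_{TU} 𝟙[t,∞) + Σ_{GU} 𝟙[u,v)` (so that `w_U ≤ F`). [cite: CostaPereira1989, (2.12)/(2.14) (block comparison)] -/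
private def wU (r : ℕ) : ℤ :=
  tail 1 r - (BU.map fun b => blk b.1 b.2 r).sum - (TU.map fun t => tail t r).sum
    + (GU.map fun b => blk b.1 b.2 r).sum

/-- A block indicator vanishes to the right of the block. [folklore] -/
private theorem blk_eq_zero_of_le {u v r : ℕ} (h : v ≤ r) : blk u v r = 0 := by
  unfold blk; rw [if_neg]; omega

/-- A tail indicator is `1` on the tail. [folklore] -/
private theorem tail_eq_one_of_le {t r : ℕ} (h : t ≤ r) : tail t r = 1 := by
  unfold tail; rw [if_pos h]

/-- All block indicators vanish beyond the last block. [folklore] -/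
private theorem sum_blk_eq_zero (l : List (ℕ × ℕ)) (r : ℕ) (h : ∀ b ∈ l, b.2 ≤ r) :
    (l.map fun b => blk b.1 b.2 r).sum = 0 := by
  induction l with
  | nil => simp
  | cons b l ih =>
    simp only [List.map_cons, List.sum_cons]
    rw [blk_eq_zero_of_le (h b (by simp)), ih (fun b' hb' => h b' (by simp [hb']))]; simp

/-- All tail indicators are `1` beyond the last threshold. [folklore] -/
private theorem sum_tail_eq_length (l : List ℕ) (r : ℕ) (h : ∀ t ∈ l, t ≤ r) :
    (l.map fun t => tail t r).sum = l.length := by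
  induction l with
  | nil => simp
  | cons t l ih =>
    simp only [List.map_cons, List.sum_cons, List.length_cons]
    rw [tail_eq_one_of_le (h t (by simp)), ih (fun t' ht' => h t' (by simp [ht']))]; push_cast; ring

/-- `w_L = 4` from `2000` on. [folklore] -/
private theorem wL_eq_four {r : ℕ} (h : 2000 ≤ r) : wL r = 4 := by
  have hB : ∀ b ∈ BL, b.2 ≤ 2000 := by decide
  have hT : ∀ t ∈ TL, t ≤ 2000 := by decide
  rw [wL, tail_eq_one_of_le (show 1 ≤ r by omega), sum_blk_eq_zero BL r (fun b hb => (hB b hb).trans h),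
    sum_tail_eq_length TL r (fun t ht => (hT t ht).trans h)]
  simp [TL]

/-- `w_U = −1` from `2000` on. [folklore] -/
private theorem wU_eq_neg_one {r : ℕ} (h : 2000 ≤ r) : wU r = -1 := by
  have hB : ∀ b ∈ BU, b.2 ≤ 2000 := by decide
  have hT : ∀ t ∈ TU, t ≤ 2000 := by decide
  have hG : ∀ b ∈ GU, b.2 ≤ 2000 := by decide
  rw [wU, tail_eq_one_of_le (show 1 ≤ r by omega), sum_blk_eq_zero BU r (fun b hb => (hB b hb).trans h),
    sum_tail_eq_length TU r (fun t ht => (hT t ht).trans h),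
    sum_blk_eq_zero GU r (fun b hb => (hG b hb).trans h)]
  simp [TU]

/-- **Lower pointwise comparison `F ≤ w_L`** (kernel check below `2000`, `F ≤ 4` above). [cite: CostaPereira1989, p. 316 (the intervals `[b_k, c_k)` where `F ≥ s`), this file's design] -/
private theorem F_le_wL (r : ℕ) : F r ≤ wL r := by
  rcases lt_or_ge r 2000 with h | h
  · have hdec : ∀ s < 2000, F s ≤ wL s := by decide +kernel
    exact hdec r h
  · rw [wL_eq_four h]; exact (F_range r).2

/-- **Upper pointwise comparison `w_U ≤ F`** (kernel check below `2000`, `−1 ≤ F` above). [cite: CostaPereira1989, p. 316 (the intervals where `F < s`), this file's design] -/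
private theorem wU_le_F (r : ℕ) : wU r ≤ F r := by
  rcases lt_or_ge r 2000 with h | h
  · have hdec : ∀ s < 2000, wU s ≤ F s := by decide +kernel
    exact hdec r h
  · rw [wU_eq_neg_one h]; exact (F_range r).1

/-! ### §3 Base range by kernel computation: `lcm(1,…,n)⁴` against powers of two -/

/-- `k_lo(n) = ⌈4 · 0.9636 (n+1) / 0.6931471⌉` (integer arithmetic). [folklore] -/
private def kLo (n : ℕ) : ℕ := (4 * 2409 * (n + 1) * 10000000 + (2500 * 6931471 - 1)) / (2500 * 6931471)

/-- `k_hi(n) = ⌊4 · 1.0364 n / 0.6931472⌋` (integer arithmetic). [folklore] -/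
private def kHi (n : ℕ) : ℕ := (4 * 2591 * n * 10000000) / (2500 * 6931472)

/-- The test at `m` with `L = lcm(1,…,m)`: `2^{k_lo} ≤ L⁴` (if `m ≥ 227`) and `L⁴ ≤ 2^{k_hi}`
(if `m ≥ 201`), together with the rounding certificates for `k_lo`, `k_hi`. [folklore] -/
private def stepOK (m L : ℕ) : Bool :=
  (decide (m < 227) ||
      (decide (4 * 2409 * (m + 1) * 10000000 ≤ kLo m * (2500 * 6931471)) && decide (2 ^ kLo m ≤ L ^ 4)))
    && (decide (m < 201) ||
      (decide (kHi m * (2500 * 6931472) ≤ 4 * 2591 * m * 10000000) && decide (L ^ 4 ≤ 2 ^ kHi m)))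

/-- Run the test for `m = n+1, …, n+fuel`, carrying `L = lcm(1,…,m)`. [folklore] -/
private def cpCheck : ℕ → ℕ → ℕ → Bool
  | _, _, 0 => true
  | n, L, fuel + 1 => stepOK (n + 1) (Nat.lcm (n + 1) L) && cpCheck (n + 1) (Nat.lcm (n + 1) L) fuel

/-- `lcm(1,…,n+fuel)` from `L = lcm(1,…,n)`. [folklore] -/
private def lcmIter : ℕ → ℕ → ℕ → ℕ
  | _, L, 0 => L
  | n, L, fuel + 1 => lcmIter (n + 1) (Nat.lcm (n + 1) L) fuel

/-- `c` chunks of `5000` steps each. [folklore] -/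
private def cpChunks : ℕ → ℕ → ℕ → Bool
  | _, _, 0 => true
  | n, L, c + 1 => cpCheck n L 5000 && cpChunks (n + 5000) (lcmIter n L 5000) c


/-- Soundness of `cpCheck`: every step in the window passes `stepOK` at the true `lcm(1,…,m)`. [folklore] -/
private theorem cpCheck_sound : ∀ (fuel n L : ℕ), cpCheck n L fuel = true → L = Nat.lcmUpto n →
    ∀ m, n < m → m ≤ n + fuel → stepOK m (Nat.lcmUpto m) = true := by
  intro fuel
  induction fuel with
  | zero => intro n L _ _ m h1 h2; omega
  | succ fuel ih =>
    intro n L h hL m h1 h2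
    simp only [cpCheck, Bool.and_eq_true] at h
    obtain ⟨hstep, hrest⟩ := h
    have hL' : Nat.lcm (n + 1) L = Nat.lcmUpto (n + 1) := by rw [hL, Literature.NumberTheory.LFunctions.SchoenfeldBound.lcmUpto_succ]
    rcases Nat.lt_or_ge (n + 1) m with hlt | hge
    · exact ih (n + 1) _ hrest hL' m hlt (by omega)
    · have hm : m = n + 1 := by omega
      subst hm
      rwa [hL'] at hstep

/-- `lcmIter` computes `lcm(1,…,n+fuel)`. [folklore] -/
private theorem lcmIter_eq : ∀ (fuel n L : ℕ), L = Nat.lcmUpto n → lcmIter n L fuel = Nat.lcmUpto (n + fuel) := by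
  intro fuel
  induction fuel with
  | zero => intro n L hL; simpa [lcmIter] using hL
  | succ fuel ih =>
    intro n L hL
    simp only [lcmIter]
    rw [ih (n + 1) _ (by rw [hL, Literature.NumberTheory.LFunctions.SchoenfeldBound.lcmUpto_succ]), Nat.add_right_comm, Nat.add_assoc]

/-- Soundness of the chunked run. [folklore] -/
private theorem cpChunks_sound : ∀ (c n L : ℕ), cpChunks n L c = true → L = Nat.lcmUpto n →
    ∀ m, n < m → m ≤ n + 5000 * c → stepOK m (Nat.lcmUpto m) = true := by
  intro c
  induction c with
  | zero => intro n L _ _ m h1 h2; omega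
  | succ c ih =>
    intro n L h hL m h1 h2
    simp only [cpChunks, Bool.and_eq_true] at h
    obtain ⟨hchunk, hrest⟩ := h
    rcases Nat.lt_or_ge (n + 5000) m with hlt | hge
    · exact ih (n + 5000) _ hrest (lcmIter_eq 5000 n L hL) m hlt (by omega)
    · exact cpCheck_sound 5000 n L hchunk hL m h1 hge

/-- **The kernel computation** (10 chunks of 5000: `1 ≤ m ≤ 50000`). [folklore] -/
private theorem cpChunks_holds : cpChunks 0 1 10 = true := by
  decide +kernel

/-- Every `1 ≤ m ≤ 50000` passes the test. [folklore] -/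
private theorem stepOK_all {m : ℕ} (h1 : 1 ≤ m) (h2 : m ≤ 50000) : stepOK m (Nat.lcmUpto m) = true :=
  cpChunks_sound 10 0 1 cpChunks_holds (by simp [Nat.lcmUpto]) m h1 (by omega)

/-- `0.9636 (n+1) ≤ ψ(n)` for `227 ≤ n ≤ 50000` (kernel: `lcm(1..n)⁴ ≥ 2^{k_lo}`). [cite: CostaPereira1989, Table I, p. 334 (`λ⁻(227) = 0.9676432`; proved here in weakened form)] -/
private theorem psi_nat_ge {n : ℕ} (h1 : 227 ≤ n) (h2 : n ≤ 50000) :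
    0.9636 * ((n : ℝ) + 1) ≤ ψ (n : ℝ) := by
  have h := stepOK_all (by omega) h2
  have hn : ¬ n < 227 := by omega
  simp only [stepOK, Bool.and_eq_true, Bool.or_eq_true, decide_eq_true_eq, hn, false_or] at h
  obtain ⟨⟨hk, hpow⟩, -⟩ := h
  have hL0 : (0 : ℝ) < Nat.lcmUpto n := by exact_mod_cast Nat.lcmUpto_pos n
  have hlog : (kLo n : ℝ) * Real.log 2 ≤ 4 * Real.log (Nat.lcmUpto n) := by
    have h' : (2 : ℝ) ^ kLo n ≤ ((Nat.lcmUpto n : ℝ)) ^ 4 := by exact_mod_cast hpow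
    have := Real.log_le_log (by positivity) h'
    rwa [Real.log_pow, Real.log_pow] at this
  have hk' : (4 * 2409 * ((n : ℝ) + 1) * 10000000) ≤ (kLo n : ℝ) * (2500 * 6931471) := by
    exact_mod_cast hk
  have hl2 := Real.log_two_gt_d9
  have hkk : (kLo n : ℝ) * 0.6931471 ≤ (kLo n : ℝ) * Real.log 2 :=
    mul_le_mul_of_nonneg_left (by linarith) (Nat.cast_nonneg _)
  rw [Chebyshev.psi_eq_log_lcmUpto]
  linarith

/-- `ψ(n) ≤ 1.0364 n` for `201 ≤ n ≤ 50000` (kernel: `lcm(1..n)⁴ ≤ 2^{k_hi}`). [cite: CostaPereira1989, Table I, p. 334 (`λ⁺(201) = 1.0272755`; proved here in weakened form)] -/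
private theorem psi_nat_le {n : ℕ} (h1 : 201 ≤ n) (h2 : n ≤ 50000) : ψ (n : ℝ) ≤ 1.0364 * n := by
  have h := stepOK_all (by omega) h2
  have hn : ¬ n < 201 := by omega
  simp only [stepOK, Bool.and_eq_true, Bool.or_eq_true, decide_eq_true_eq, hn, false_or] at h
  obtain ⟨-, hk, hpow⟩ := h
  have hL0 : (0 : ℝ) < Nat.lcmUpto n := by exact_mod_cast Nat.lcmUpto_pos n
  have hlog : 4 * Real.log (Nat.lcmUpto n) ≤ (kHi n : ℝ) * Real.log 2 := by
    have h' : ((Nat.lcmUpto n : ℝ)) ^ 4 ≤ (2 : ℝ) ^ kHi n := by exact_mod_cast hpow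
    have := Real.log_le_log (by positivity) h'
    rwa [Real.log_pow, Real.log_pow] at this
  have hk' : (kHi n : ℝ) * (2500 * 6931472) ≤ 4 * 2591 * (n : ℝ) * 10000000 := by
    exact_mod_cast hk
  have hl2 := Real.log_two_lt_d9
  have hkk : (kHi n : ℝ) * Real.log 2 ≤ (kHi n : ℝ) * 0.6931472 :=
    mul_le_mul_of_nonneg_left (by linarith) (Nat.cast_nonneg _)
  rw [Chebyshev.psi_eq_log_lcmUpto]
  linarith

/-- Real form of the base range: `0.9636 x ≤ ψ(x)` for `227 ≤ x < 50001`. [folklore] -/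
private theorem psi_ge_base1 {x : ℝ} (hx : 227 ≤ x) (hx' : x < 50001) : 0.9636 * x ≤ ψ x := by
  rw [Chebyshev.psi_eq_psi_coe_floor]
  have hx0 : 0 ≤ x := by linarith
  have hfl : x < ⌊x⌋₊ + 1 := Nat.lt_floor_add_one x
  have hn1 : 227 ≤ ⌊x⌋₊ := Nat.le_floor (by simpa using hx)
  have hn2 : ⌊x⌋₊ ≤ 50000 := by
    have : ⌊x⌋₊ < 50001 := Nat.floor_lt hx0 |>.mpr (by simpa using hx')
    omega
  have := psi_nat_ge hn1 hn2
  linarith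

/-- Real form of the base range: `ψ(x) ≤ 1.0364 x` for `201 ≤ x < 50001`. [folklore] -/
private theorem psi_le_base1 {x : ℝ} (hx : 201 ≤ x) (hx' : x < 50001) : ψ x ≤ 1.0364 * x := by
  rw [Chebyshev.psi_eq_psi_coe_floor]
  have hx0 : 0 ≤ x := by linarith
  have hfl : (⌊x⌋₊ : ℝ) ≤ x := Nat.floor_le hx0
  have hn1 : 201 ≤ ⌊x⌋₊ := Nat.le_floor (by simpa using hx)
  have hn2 : ⌊x⌋₊ ≤ 50000 := by
    have : ⌊x⌋₊ < 50001 := Nat.floor_lt hx0 |>.mpr (by simpa using hx')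
    omega
  have := psi_nat_le hn1 hn2
  linarith


/-! ### §4 `V = Σ_r ν(r) T(N/r) = Σ_k Λ(k) F(⌊N/k⌋)` and the two `ψ`-comparisons -/

noncomputable section

open ArithmeticFunction hiding log id
open Literature.NumberTheory.LFunctions (abs_theta_sub_le_smallRange psi_sub_theta_le_of_lt_two_pow_32)
open Literature.NumberTheory.LFunctions.Sylvester (T T_div psi_div_eq_sum abs_T_div_sub_le
  log_le_linear log_seven_bounds)

/-- `V(N) = Σ_r ν(r) T(⌊N/r⌋)` (`T(N) = log N!`, the tree's `Sylvester.T`) for the scheme `ν₁₇` — Costa Pereira's `σ`.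
[cite: CostaPereira1989, (2.1)] -/
private def V (N : ℕ) : ℝ :=
  T N - T (N / 2) - T (N / 3) - T (N / 5) + T (N / 6) - T (N / 7) + T (N / 10) - T (N / 11)
    - T (N / 13) + T (N / 14) + T (N / 15) - T (N / 30) - T (N / 42) - T (N / 110) + T (N / 182)

/-- `V(N) = Σ_{k ≤ N} Λ(k) F(⌊N/k⌋)`. [cite: CostaPereira1989, §1 (1.10)–(1.13) with `φ = ψ` (p. 309: `σ(x) = Σ_n (F(r_n) − F(r_{n−1})) ψ(x/r_n)`)] -/
private theorem V_eq_sum (N : ℕ) : V N = ∑ k ∈ Ioc 0 N, Λ k * (F (N / k) : ℝ) := by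
  have h1 : T N = ∑ k ∈ Ioc 0 N, Λ k * ((N / k / 1 : ℕ) : ℝ) := by
    rw [← T_div N Nat.one_pos, Nat.div_one]
  rw [V, h1, T_div N (by norm_num : 0 < 2), T_div N (by norm_num : 0 < 3), T_div N (by norm_num : 0 < 5),
    T_div N (by norm_num : 0 < 6), T_div N (by norm_num : 0 < 7), T_div N (by norm_num : 0 < 10),
    T_div N (by norm_num : 0 < 11), T_div N (by norm_num : 0 < 13), T_div N (by norm_num : 0 < 14),
    T_div N (by norm_num : 0 < 15), T_div N (by norm_num : 0 < 30), T_div N (by norm_num : 0 < 42),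
    T_div N (by norm_num : 0 < 110), T_div N (by norm_num : 0 < 182)]
  simp only [← Finset.sum_sub_distrib, ← Finset.sum_add_distrib, ← mul_sub, ← mul_add]
  refine Finset.sum_congr rfl fun k _ => ?_
  simp only [F, Nat.div_one, Int.cast_sub, Int.cast_add, Int.cast_natCast]

/-- `Σ_{(u,v) ∈ l} (ψ(x/u) − ψ(x/v))`. [folklore] -/
private def blkPsi (x : ℝ) (l : List (ℕ × ℕ)) : ℝ :=
  (l.map fun b : ℕ × ℕ => ψ (x / (b.1 : ℝ)) - ψ (x / (b.2 : ℝ))).sum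

/-- `Σ_{t ∈ l} ψ(x/t)`. [folklore] -/
private def tailPsi (x : ℝ) (l : List ℕ) : ℝ := (l.map fun t : ℕ => ψ (x / (t : ℝ))).sum

/-- A block indicator is a difference of two tail indicators. [folklore] -/
private theorem blk_eq_sub {u v : ℕ} (huv : u ≤ v) (r : ℕ) :
    blk u v r = (if u ≤ r then 1 else 0) - (if v ≤ r then 1 else 0) := by
  unfold blk; split_ifs <;> omega

/-- `Σ_k Λ(k) 𝟙[t ≤ ⌊x⌋/k] = ψ(x/t)`. [folklore] -/
private theorem sum_tail (x : ℝ) {t : ℕ} (ht : 0 < t) :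
    ∑ k ∈ Ioc 0 ⌊x⌋₊, Λ k * (tail t (⌊x⌋₊ / k) : ℝ) = ψ (x / t) := by
  rw [psi_div_eq_sum x ht]; rfl

/-- `Σ_k Λ(k) 𝟙[u ≤ ⌊x⌋/k < v] = ψ(x/u) − ψ(x/v)`. [folklore] -/
private theorem sum_blk (x : ℝ) {u v : ℕ} (hu : 0 < u) (huv : u ≤ v) :
    ∑ k ∈ Ioc 0 ⌊x⌋₊, Λ k * (blk u v (⌊x⌋₊ / k) : ℝ) = ψ (x / u) - ψ (x / v) := by
  rw [psi_div_eq_sum x hu, psi_div_eq_sum x (lt_of_lt_of_le hu huv), ← Finset.sum_sub_distrib]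
  refine Finset.sum_congr rfl fun k _ => ?_
  rw [← mul_sub, blk_eq_sub huv]; push_cast; ring

/-- Linearity over a list of blocks. [folklore] -/
private theorem sum_blkList (x : ℝ) (l : List (ℕ × ℕ)) (hl : ∀ b ∈ l, 0 < b.1 ∧ b.1 ≤ b.2) :
    ∑ k ∈ Ioc 0 ⌊x⌋₊, Λ k * (((l.map fun b => blk b.1 b.2 (⌊x⌋₊ / k)).sum : ℤ) : ℝ) = blkPsi x l := by
  induction l with
  | nil => simp [blkPsi]
  | cons b l ih =>
    have hb := hl b (by simp)
    have ih' := ih (fun b' hb' => hl b' (by simp [hb']))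
    simp only [List.map_cons, List.sum_cons, Int.cast_add, mul_add, Finset.sum_add_distrib]
    rw [sum_blk x hb.1 hb.2, ih']
    simp [blkPsi]

/-- Linearity over a list of tails. [folklore] -/
private theorem sum_tailList (x : ℝ) (l : List ℕ) (hl : ∀ t ∈ l, 0 < t) :
    ∑ k ∈ Ioc 0 ⌊x⌋₊, Λ k * (((l.map fun t => tail t (⌊x⌋₊ / k)).sum : ℤ) : ℝ) = tailPsi x l := by
  induction l with
  | nil => simp [tailPsi]
  | cons t l ih =>
    have ht := hl t (by simp)
    have ih' := ih (fun t' ht' => hl t' (by simp [ht']))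
    simp only [List.map_cons, List.sum_cons, Int.cast_add, mul_add, Finset.sum_add_distrib]
    rw [sum_tail x ht, ih']
    simp [tailPsi]

/-- `Σ_k Λ(k) w_L(⌊x⌋/k) = ψ(x) + Σ_{BL} (ψ(x/u) − ψ(x/v)) + Σ_{TL} ψ(x/t)`. [folklore] -/
private theorem sum_wL (x : ℝ) :
    ∑ k ∈ Ioc 0 ⌊x⌋₊, Λ k * (wL (⌊x⌋₊ / k) : ℝ) = ψ x + blkPsi x BL + tailPsi x TL := by
  simp only [wL, Int.cast_add, mul_add, Finset.sum_add_distrib]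
  rw [sum_tail x Nat.one_pos, sum_blkList x BL (by decide), sum_tailList x TL (by decide)]
  simp

/-- `Σ_k Λ(k) w_U(⌊x⌋/k) = ψ(x) − Σ_{BU} (…) − Σ_{TU} ψ(x/t) + Σ_{GU} (…)`. [folklore] -/
private theorem sum_wU (x : ℝ) :
    ∑ k ∈ Ioc 0 ⌊x⌋₊, Λ k * (wU (⌊x⌋₊ / k) : ℝ) =
      ψ x - blkPsi x BU - tailPsi x TU + blkPsi x GU := by
  simp only [wU, Int.cast_add, Int.cast_sub, mul_add, mul_sub, Finset.sum_add_distrib,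
    Finset.sum_sub_distrib]
  rw [sum_tail x Nat.one_pos, sum_blkList x BU (by decide), sum_tailList x TU (by decide),
    sum_blkList x GU (by decide)]
  simp

/-- **Lower comparison**: `V(⌊x⌋) ≤ ψ(x) + Σ_{BL} (ψ(x/u) − ψ(x/v)) + Σ_{TL} ψ(x/t)` — Costa Pereira's (2.13)
`ψ(x) ≤ σ(x) + Σ ψ(x/a_s) − Σ (ψ(x/b_k) − ψ(x/c_k))` read from the other side, for this file's blocks. [cite: CostaPereira1989, (2.13), p. 316] -/
private theorem V_le_psi_comb (x : ℝ) : V ⌊x⌋₊ ≤ ψ x + blkPsi x BL + tailPsi x TL := by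
  rw [V_eq_sum, ← sum_wL]
  refine Finset.sum_le_sum fun k _ => mul_le_mul_of_nonneg_left ?_ vonMangoldt_nonneg
  exact_mod_cast F_le_wL (⌊x⌋₊ / k)

/-- **Upper comparison**: `ψ(x) − Σ_{BU} (ψ(x/u) − ψ(x/v)) − Σ_{TU} ψ(x/t) + Σ_{GU} (ψ(x/u) − ψ(x/v)) ≤ V(⌊x⌋)` —
Costa Pereira's (2.14) for this file's blocks. [cite: CostaPereira1989, (2.14), p. 316] -/
private theorem psi_comb_le_V (x : ℝ) : ψ x - blkPsi x BU - tailPsi x TU + blkPsi x GU ≤ V ⌊x⌋₊ := by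
  rw [V_eq_sum, ← sum_wU]
  refine Finset.sum_le_sum fun k _ => mul_le_mul_of_nonneg_left ?_ vonMangoldt_nonneg
  exact_mod_cast wU_le_F (⌊x⌋₊ / k)

/-! ### §5 `V(x) = ω x + O(log x)` and the numerical value of `ω` -/

/-- `ω = −Σ ν(r) log r / r = (3343/15015) log 2 + (11/70) log 3 + (5/66) log 5 + (7/78) log 7
+ (1/10) log 11 + (1/14) log 13 = 1.0465244…`. [cite: CostaPereira1989, (2.2); numerical value `ω = 1.04652442…` on p. 323] -/
def ω : ℝ :=
  3343 / 15015 * Real.log 2 + 11 / 70 * Real.log 3 + 5 / 66 * Real.log 5 + 7 / 78 * Real.log 7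
    + 1 / 10 * Real.log 11 + 1 / 14 * Real.log 13

/-- `|V(⌊x⌋) − ω x| ≤ 15 log x + 30` for `x ≥ 182` — an explicit cruder form of Costa Pereira's Lemma 3
(`|σ(x) − ωx| < (s⁺ − w) log x + h + γ/x` for `x > max R`), from the tree's weak Stirling bound. [cite: CostaPereira1989, Lemma 3 (2.5), p. 314 (weaker explicit form proved here)] -/
private theorem abs_V_sub_le {x : ℝ} (hx : 182 ≤ x) : |V ⌊x⌋₊ - ω * x| ≤ 15 * Real.log x + 30 := by
  have hx0 : 0 < x := by linarith
  have e1 := abs_T_div_sub_le (x := x) (d := 1) le_rfl (by norm_num; linarith)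
  have e2 := abs_T_div_sub_le (x := x) (d := 2) (by norm_num) (by norm_num; linarith)
  have e3 := abs_T_div_sub_le (x := x) (d := 3) (by norm_num) (by norm_num; linarith)
  have e5 := abs_T_div_sub_le (x := x) (d := 5) (by norm_num) (by norm_num; linarith)
  have e6 := abs_T_div_sub_le (x := x) (d := 6) (by norm_num) (by norm_num; linarith)
  have e7 := abs_T_div_sub_le (x := x) (d := 7) (by norm_num) (by norm_num; linarith)
  have e10 := abs_T_div_sub_le (x := x) (d := 10) (by norm_num) (by norm_num; linarith)
  have e11 := abs_T_div_sub_le (x := x) (d := 11) (by norm_num) (by norm_num; linarith)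
  have e13 := abs_T_div_sub_le (x := x) (d := 13) (by norm_num) (by norm_num; linarith)
  have e14 := abs_T_div_sub_le (x := x) (d := 14) (by norm_num) (by norm_num; linarith)
  have e15 := abs_T_div_sub_le (x := x) (d := 15) (by norm_num) (by norm_num; linarith)
  have e30 := abs_T_div_sub_le (x := x) (d := 30) (by norm_num) (by norm_num; linarith)
  have e42 := abs_T_div_sub_le (x := x) (d := 42) (by norm_num) (by norm_num; linarith)
  have e110 := abs_T_div_sub_le (x := x) (d := 110) (by norm_num) (by norm_num; linarith)
  have e182 := abs_T_div_sub_le (x := x) (d := 182) (by norm_num) (by norm_num; linarith)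
  rw [Nat.div_one] at e1
  simp only [Nat.cast_one, div_one, Nat.cast_ofNat] at e1 e2 e3 e5 e6 e7 e10 e11 e13 e14 e15
  simp only [Nat.cast_ofNat] at e30 e42 e110 e182
  have hl : ∀ d : ℝ, 0 < d → Real.log (x / d) = Real.log x - Real.log d := fun d hd =>
    Real.log_div hx0.ne' hd.ne'
  have l6 : Real.log (6 : ℝ) = Real.log 2 + Real.log 3 := by
    rw [show (6 : ℝ) = 2 * 3 by norm_num, Real.log_mul (by norm_num) (by norm_num)]
  have l10 : Real.log (10 : ℝ) = Real.log 2 + Real.log 5 := by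
    rw [show (10 : ℝ) = 2 * 5 by norm_num, Real.log_mul (by norm_num) (by norm_num)]
  have l14 : Real.log (14 : ℝ) = Real.log 2 + Real.log 7 := by
    rw [show (14 : ℝ) = 2 * 7 by norm_num, Real.log_mul (by norm_num) (by norm_num)]
  have l15 : Real.log (15 : ℝ) = Real.log 3 + Real.log 5 := by
    rw [show (15 : ℝ) = 3 * 5 by norm_num, Real.log_mul (by norm_num) (by norm_num)]
  have l30 : Real.log (30 : ℝ) = Real.log 2 + Real.log 3 + Real.log 5 := by
    rw [show (30 : ℝ) = 2 * 3 * 5 by norm_num, Real.log_mul (by norm_num) (by norm_num),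
      Real.log_mul (by norm_num) (by norm_num)]
  have l42 : Real.log (42 : ℝ) = Real.log 2 + Real.log 3 + Real.log 7 := by
    rw [show (42 : ℝ) = 2 * 3 * 7 by norm_num, Real.log_mul (by norm_num) (by norm_num),
      Real.log_mul (by norm_num) (by norm_num)]
  have l110 : Real.log (110 : ℝ) = Real.log 2 + Real.log 5 + Real.log 11 := by
    rw [show (110 : ℝ) = 2 * 5 * 11 by norm_num, Real.log_mul (by norm_num) (by norm_num),
      Real.log_mul (by norm_num) (by norm_num)]
  have l182 : Real.log (182 : ℝ) = Real.log 2 + Real.log 7 + Real.log 13 := by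
    rw [show (182 : ℝ) = 2 * 7 * 13 by norm_num, Real.log_mul (by norm_num) (by norm_num),
      Real.log_mul (by norm_num) (by norm_num)]
  have key : (x * Real.log x - x) - (x / 2 * Real.log (x / 2) - x / 2) - (x / 3 * Real.log (x / 3) - x / 3)
      - (x / 5 * Real.log (x / 5) - x / 5) + (x / 6 * Real.log (x / 6) - x / 6)
      - (x / 7 * Real.log (x / 7) - x / 7) + (x / 10 * Real.log (x / 10) - x / 10)
      - (x / 11 * Real.log (x / 11) - x / 11) - (x / 13 * Real.log (x / 13) - x / 13)
      + (x / 14 * Real.log (x / 14) - x / 14) + (x / 15 * Real.log (x / 15) - x / 15)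
      - (x / 30 * Real.log (x / 30) - x / 30) - (x / 42 * Real.log (x / 42) - x / 42)
      - (x / 110 * Real.log (x / 110) - x / 110) + (x / 182 * Real.log (x / 182) - x / 182)
      = ω * x := by
    rw [hl 2 (by norm_num), hl 3 (by norm_num), hl 5 (by norm_num), hl 6 (by norm_num),
      hl 7 (by norm_num), hl 10 (by norm_num), hl 11 (by norm_num), hl 13 (by norm_num),
      hl 14 (by norm_num), hl 15 (by norm_num), hl 30 (by norm_num), hl 42 (by norm_num),
      hl 110 (by norm_num), hl 182 (by norm_num), l6, l10, l14, l15, l30, l42, l110, l182, ω]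
    ring
  rw [abs_le] at e1 e2 e3 e5 e6 e7 e10 e11 e13 e14 e15 e30 e42 e110 e182 ⊢
  rw [V]
  constructor <;> linarith [e1.1, e1.2, e2.1, e2.2, e3.1, e3.2, e5.1, e5.2, e6.1, e6.2, e7.1, e7.2,
    e10.1, e10.2, e11.1, e11.2, e13.1, e13.2, e14.1, e14.2, e15.1, e15.2, e30.1, e30.2, e42.1,
    e42.2, e110.1, e110.2, e182.1, e182.2]

/-- `2.3978952 < log 11 < 2.3978954` (`log 11 = 2 log 2 + log 3 + log(1 − 1/12)`). [folklore] -/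
private theorem log_eleven_bounds : (2.3978952 : ℝ) < Real.log 11 ∧ Real.log 11 < 2.3978954 := by
  have h := Real.abs_log_sub_add_sum_range_le (x := (1 / 12 : ℝ))
    (by rw [abs_of_pos (by norm_num)]; norm_num) 7
  rw [abs_of_pos (by norm_num : (0 : ℝ) < 1 / 12)] at h
  have hs : ∑ i ∈ range 7, (1 / 12 : ℝ) ^ (i + 1) / (i + 1) = 36374041 / 418037760 := by
    simp only [sum_range_succ, sum_range_zero]
    norm_num
  have h1112 : Real.log ((1 : ℝ) - 1 / 12) = Real.log 11 - (2 * Real.log 2 + Real.log 3) := by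
    rw [show (1 : ℝ) - 1 / 12 = 11 / (2 ^ 2 * 3) by norm_num, Real.log_div (by norm_num) (by norm_num),
      Real.log_mul (by norm_num) (by norm_num), Real.log_pow]; push_cast; ring
  rw [hs, h1112] at h
  have h2 := Real.log_two_gt_d9
  have h2' := Real.log_two_lt_d9
  have h3 := Real.log_three_gt_d9
  have h3' := Real.log_three_lt_d9
  have h' := abs_le.1 h
  norm_num at h'
  constructor <;> linarith [h'.1, h'.2]

/-- `2.5649492 < log 13 < 2.5649496` (`log 13 = log 2 + log 7 + log(1 − 1/14)`). [folklore] -/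
private theorem log_thirteen_bounds : (2.5649492 : ℝ) < Real.log 13 ∧ Real.log 13 < 2.5649496 := by
  have h := Real.abs_log_sub_add_sum_range_le (x := (1 / 14 : ℝ))
    (by rw [abs_of_pos (by norm_num)]; norm_num) 7
  rw [abs_of_pos (by norm_num : (0 : ℝ) < 1 / 14)] at h
  have hs : ∑ i ∈ range 7, (1 / 14 : ℝ) ^ (i + 1) / (i + 1) = 410129003 / 5534208960 := by
    simp only [sum_range_succ, sum_range_zero]
    norm_num
  have h1314 : Real.log ((1 : ℝ) - 1 / 14) = Real.log 13 - (Real.log 2 + Real.log 7) := by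
    rw [show (1 : ℝ) - 1 / 14 = 13 / (2 * 7) by norm_num, Real.log_div (by norm_num) (by norm_num),
      Real.log_mul (by norm_num) (by norm_num)]
  rw [hs, h1314] at h
  have h2 := Real.log_two_gt_d9
  have h2' := Real.log_two_lt_d9
  have h7 := log_seven_bounds
  have h' := abs_le.1 h
  norm_num at h'
  constructor <;> linarith [h'.1, h'.2, h7.1, h7.2]

/-- `1.0465243 ≤ ω ≤ 1.0465245`. [cite: CostaPereira1989, p. 323 (`ω = 1.04652442…`)] -/
theorem ω_bounds : (1.0465243 : ℝ) ≤ ω ∧ ω ≤ 1.0465245 := by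
  have h2 := Real.log_two_gt_d9
  have h2' := Real.log_two_lt_d9
  have h3 := Real.log_three_gt_d9
  have h3' := Real.log_three_lt_d9
  have h5 := Real.log_five_gt_d9
  have h5' := Real.log_five_lt_d9
  have h7 := log_seven_bounds
  have h11 := log_eleven_bounds
  have h13 := log_thirteen_bounds
  rw [ω]
  constructor <;> linarith [h7.1, h7.2, h11.1, h11.2, h13.1, h13.2]

/-! ### §6 The base range `50000 ≤ x ≤ 10⁶` from the kernel-certified `θ`-table of the tree -/

/-- `log x ≤ 12` for `0 < x ≤ 10⁵`. [folklore] -/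
private theorem log_le_12 {x : ℝ} (hx : 0 < x) (hx' : x ≤ 100000) : Real.log x ≤ 12 := by
  have h : (100000 : ℝ) ≤ Real.exp 12 := by
    have h1 : Real.exp 12 = Real.exp 1 ^ 12 := by rw [← Real.exp_nat_mul]; norm_num
    rw [h1]
    have h2 := Real.exp_one_gt_d9
    calc (100000 : ℝ) ≤ 2.7182818283 ^ 12 := by norm_num
      _ ≤ Real.exp 1 ^ 12 := pow_le_pow_left₀ (by norm_num) h2.le 12
  calc Real.log x ≤ Real.log 100000 := Real.log_le_log hx hx'
    _ ≤ Real.log (Real.exp 12) := Real.log_le_log (by norm_num) h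
    _ = 12 := Real.log_exp _

/-- `log x ≤ 14` for `0 < x ≤ 10⁶`. [folklore] -/
private theorem log_le_14 {x : ℝ} (hx : 0 < x) (hx' : x ≤ 1000000) : Real.log x ≤ 14 := by
  have h : (1000000 : ℝ) ≤ Real.exp 14 := by
    have h1 : Real.exp 14 = Real.exp 1 ^ 14 := by rw [← Real.exp_nat_mul]; norm_num
    rw [h1]
    have h2 := Real.exp_one_gt_d9
    calc (1000000 : ℝ) ≤ 2.7182818283 ^ 14 := by norm_num
      _ ≤ Real.exp 1 ^ 14 := pow_le_pow_left₀ (by norm_num) h2.le 14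
  calc Real.log x ≤ Real.log 1000000 := Real.log_le_log hx hx'
    _ ≤ Real.log (Real.exp 14) := Real.log_le_log (by norm_num) h
    _ = 14 := Real.log_exp _

/-- Schoenfeld's error `√x log²x/(8π) ≤ c √x` once `log x ≤ l` and `l² ≤ 8π c`. [folklore] -/
private theorem schoenfeld_err_le' {x l c : ℝ} (hx : 1 ≤ x) (hl : Real.log x ≤ l) (hc : l ^ 2 ≤ 25.13272 * c) :
    Real.sqrt x * Real.log x ^ 2 / (8 * Real.pi) ≤ c * Real.sqrt x := by
  have hlog0 : 0 ≤ Real.log x := Real.log_nonneg hx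
  have hpi := Real.pi_gt_d6
  rw [div_le_iff₀ (by positivity)]
  have hc0 : 0 ≤ c := by nlinarith [sq_nonneg l]
  have h8c : 25.13272 * c ≤ c * (8 * Real.pi) := by nlinarith
  have hsq : Real.log x ^ 2 ≤ c * (8 * Real.pi) := by
    have : Real.log x ^ 2 ≤ l ^ 2 := pow_le_pow_left₀ hlog0 hl 2
    linarith
  have hs0 : 0 ≤ Real.sqrt x := Real.sqrt_nonneg x
  calc Real.sqrt x * Real.log x ^ 2 ≤ Real.sqrt x * (c * (8 * Real.pi)) :=
        mul_le_mul_of_nonneg_left hsq hs0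
    _ = c * Real.sqrt x * (8 * Real.pi) := by ring

/-- The two bounds on `[50000, 10⁶]` from `|θ(x) − x| ≤ √x log²x/(8π)` (`599 ≤ x ≤ 8886113`, kernel
table of the tree) and `ψ − θ ≤ √x + (4/3) x^{1/3}` (`x < 2³²`). [folklore] -/
private theorem psi_bounds_base2 {x : ℝ} (hx : 50000 ≤ x) (hx' : x ≤ 1000000) :
    0.9636 * x ≤ ψ x ∧ ψ x ≤ 1.0364 * x := by
  have hx1 : 1 ≤ x := by linarith
  have hx0 : 0 ≤ x := by linarith
  have hθ := abs_theta_sub_le_smallRange (by linarith) (by linarith)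
  have hE := psi_sub_theta_le_of_lt_two_pow_32 hx1 (by norm_num; linarith)
  have hθψ := Chebyshev.theta_le_psi x
  have hcube : x ^ ((1 : ℝ) / 3) ≤ Real.sqrt x := by
    rw [Real.sqrt_eq_rpow]
    exact Real.rpow_le_rpow_of_exponent_le hx1 (by norm_num)
  have hxx : Real.sqrt x * Real.sqrt x = x := Real.mul_self_sqrt hx0
  have hs0 : 0 ≤ Real.sqrt x := Real.sqrt_nonneg x
  rcases le_or_gt x 100000 with h5 | h5
  · have herr := schoenfeld_err_le' (c := 5.73) hx1 (log_le_12 (by linarith) h5) (by norm_num)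
    have hsq : 223 ≤ Real.sqrt x := by
      rw [show (223 : ℝ) = Real.sqrt (223 ^ 2) by rw [Real.sqrt_sq (by norm_num)]]
      exact Real.sqrt_le_sqrt (by nlinarith)
    have h1 := (abs_le.1 hθ).1
    have h2 := (abs_le.1 hθ).2
    constructor <;> nlinarith
  · have herr := schoenfeld_err_le' (c := 7.8) hx1 (log_le_14 (by linarith) hx') (by norm_num)
    have hsq : 316 ≤ Real.sqrt x := by
      rw [show (316 : ℝ) = Real.sqrt (316 ^ 2) by rw [Real.sqrt_sq (by norm_num)]]
      exact Real.sqrt_le_sqrt (by nlinarith)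
    have h1 := (abs_le.1 hθ).1
    have h2 := (abs_le.1 hθ).2
    constructor <;> nlinarith

/-! ### §7 The induction (`x ≥ 10⁶`) -/

/-- Upper bound for a block sum from the inductive bounds at `x/u`, `x/v`. [folklore] -/
private theorem blkPsi_le {x : ℝ} (hx : 0 < x) (l : List (ℕ × ℕ))
    (hl : ∀ b ∈ l, 17 ≤ b.1 ∧ b.1 ≤ b.2 ∧ b.2 ≤ 2000)
    (IH : ∀ y : ℝ, x / 2000 ≤ y → y ≤ x / 17 → 0.9636 * y ≤ ψ y ∧ ψ y ≤ 1.0364 * y) :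
    blkPsi x l ≤ x * (l.map fun b : ℕ × ℕ => (1.0364 / (b.1 : ℝ) - 0.9636 / (b.2 : ℝ) : ℝ)).sum := by
  induction l with
  | nil => simp [blkPsi]
  | cons b l ih =>
    obtain ⟨hu, huv, hv⟩ := hl b (by simp)
    have ih' := ih (fun b' hb' => hl b' (by simp [hb']))
    have hu0 : (0 : ℝ) < b.1 := by exact_mod_cast (show 0 < b.1 by omega)
    have hv0 : (0 : ℝ) < b.2 := by exact_mod_cast (show 0 < b.2 by omega)
    have hu' : (17 : ℝ) ≤ b.1 := by exact_mod_cast hu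
    have hv' : (b.2 : ℝ) ≤ 2000 := by exact_mod_cast hv
    have huv' : (b.1 : ℝ) ≤ b.2 := by exact_mod_cast huv
    have hyu := (IH (x / b.1) (div_le_div_of_nonneg_left hx.le hu0 (by linarith))
      (div_le_div_of_nonneg_left hx.le (by norm_num) hu')).2
    have hyv := (IH (x / b.2) (div_le_div_of_nonneg_left hx.le hv0 hv')
      (div_le_div_of_nonneg_left hx.le (by norm_num) (by linarith))).1
    simp only [blkPsi, List.map_cons, List.sum_cons] at ih' ⊢
    have e1 : (1.0364 : ℝ) * (x / b.1) = x * (1.0364 / b.1) := by ring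
    have e2 : (0.9636 : ℝ) * (x / b.2) = x * (0.9636 / b.2) := by ring
    linarith

/-- Lower bound for a block sum from the inductive bounds at `x/u`, `x/v`. [folklore] -/
private theorem le_blkPsi {x : ℝ} (hx : 0 < x) (l : List (ℕ × ℕ))
    (hl : ∀ b ∈ l, 17 ≤ b.1 ∧ b.1 ≤ b.2 ∧ b.2 ≤ 2000)
    (IH : ∀ y : ℝ, x / 2000 ≤ y → y ≤ x / 17 → 0.9636 * y ≤ ψ y ∧ ψ y ≤ 1.0364 * y) :
    x * (l.map fun b : ℕ × ℕ => (0.9636 / (b.1 : ℝ) - 1.0364 / (b.2 : ℝ) : ℝ)).sum ≤ blkPsi x l := by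
  induction l with
  | nil => simp [blkPsi]
  | cons b l ih =>
    obtain ⟨hu, huv, hv⟩ := hl b (by simp)
    have ih' := ih (fun b' hb' => hl b' (by simp [hb']))
    have hu0 : (0 : ℝ) < b.1 := by exact_mod_cast (show 0 < b.1 by omega)
    have hv0 : (0 : ℝ) < b.2 := by exact_mod_cast (show 0 < b.2 by omega)
    have hu' : (17 : ℝ) ≤ b.1 := by exact_mod_cast hu
    have hv' : (b.2 : ℝ) ≤ 2000 := by exact_mod_cast hv
    have huv' : (b.1 : ℝ) ≤ b.2 := by exact_mod_cast huv
    have hyu := (IH (x / b.1) (div_le_div_of_nonneg_left hx.le hu0 (by linarith))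
      (div_le_div_of_nonneg_left hx.le (by norm_num) hu')).1
    have hyv := (IH (x / b.2) (div_le_div_of_nonneg_left hx.le hv0 hv')
      (div_le_div_of_nonneg_left hx.le (by norm_num) (by linarith))).2
    simp only [blkPsi, List.map_cons, List.sum_cons] at ih' ⊢
    have e1 : (0.9636 : ℝ) * (x / b.1) = x * (0.9636 / b.1) := by ring
    have e2 : (1.0364 : ℝ) * (x / b.2) = x * (1.0364 / b.2) := by ring
    linarith

/-- Upper bound for a tail sum from the inductive bounds at `x/t`. [folklore] -/
private theorem tailPsi_le {x : ℝ} (hx : 0 < x) (l : List ℕ) (hl : ∀ t ∈ l, 17 ≤ t ∧ t ≤ 2000)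
    (IH : ∀ y : ℝ, x / 2000 ≤ y → y ≤ x / 17 → 0.9636 * y ≤ ψ y ∧ ψ y ≤ 1.0364 * y) :
    tailPsi x l ≤ x * (l.map fun t : ℕ => (1.0364 / (t : ℝ) : ℝ)).sum := by
  induction l with
  | nil => simp [tailPsi]
  | cons t l ih =>
    obtain ⟨ht, ht'⟩ := hl t (by simp)
    have ih' := ih (fun t'' h'' => hl t'' (by simp [h'']))
    have ht0 : (0 : ℝ) < t := by exact_mod_cast (show 0 < t by omega)
    have ht1 : (17 : ℝ) ≤ t := by exact_mod_cast ht
    have ht2 : (t : ℝ) ≤ 2000 := by exact_mod_cast ht'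
    have hy := (IH (x / t) (div_le_div_of_nonneg_left hx.le ht0 ht2)
      (div_le_div_of_nonneg_left hx.le (by norm_num) ht1)).2
    simp only [tailPsi, List.map_cons, List.sum_cons] at ih' ⊢
    have e1 : (1.0364 : ℝ) * (x / t) = x * (1.0364 / t) := by ring
    linarith

/-- Numerical value of the lower-side block cost. [folklore] -/
private theorem cBL_le : (BL.map fun b : ℕ × ℕ => (1.0364 / (b.1 : ℝ) - 0.9636 / (b.2 : ℝ) : ℝ)).sum ≤ 0.0741078 := by
  norm_num [BL]
/-- Numerical value of the lower-side tail cost. [folklore] -/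
private theorem cTL_le : (TL.map fun t : ℕ => (1.0364 / (t : ℝ) : ℝ)).sum ≤ 0.0084926 := by
  norm_num [TL]
/-- Numerical value of the upper-side block cost. [folklore] -/
private theorem cBU_le : (BU.map fun b : ℕ × ℕ => (1.0364 / (b.1 : ℝ) - 0.9636 / (b.2 : ℝ) : ℝ)).sum ≤ 0.0069263 := by
  norm_num [BU]
/-- Numerical value of the upper-side tail cost. [folklore] -/
private theorem cTU_le : (TU.map fun t : ℕ => (1.0364 / (t : ℝ) : ℝ)).sum ≤ 0.0010364 := by
  norm_num [TU]
/-- Numerical value of the upper-side gain. [folklore] -/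
private theorem le_cGU : (0.0183605 : ℝ) ≤ (GU.map fun b : ℕ × ℕ => (0.9636 / (b.1 : ℝ) - 1.0364 / (b.2 : ℝ) : ℝ)).sum := by
  norm_num [GU]

/-- **The induction step** at `x ≥ 10⁶` (Costa Pereira's Theorem 2 step with the explicit `O(log x)` error of §5:
`0.9636 + 0.0741078 + 0.0084926 + (15·log x + 30)/x`-type budgets close with slack `≈ 3·10⁻⁴`). [cite: CostaPereira1989, Theorem 2 (2.34), pp. 318–320 (proof by induction on `n ≥ N`)] -/
private theorem step {x : ℝ} (hx : 1000000 ≤ x)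
    (IH : ∀ y : ℝ, 227 ≤ y → y ≤ x / 17 → 0.9636 * y ≤ ψ y ∧ ψ y ≤ 1.0364 * y) :
    0.9636 * x ≤ ψ x ∧ ψ x ≤ 1.0364 * x := by
  have hx0 : 0 < x := by linarith
  have IH' : ∀ y : ℝ, x / 2000 ≤ y → y ≤ x / 17 → 0.9636 * y ≤ ψ y ∧ ψ y ≤ 1.0364 * y :=
    fun y hy hy' => IH y (by rw [div_le_iff₀ (by norm_num : (0 : ℝ) < 2000)] at hy; linarith) hy'
  have hV := abs_le.1 (abs_V_sub_le (x := x) (by linarith))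
  have hω := ω_bounds
  have hlog := log_le_linear hx0
  have hlo := V_le_psi_comb x
  have hhi := psi_comb_le_V x
  have b1 := blkPsi_le hx0 BL (by decide) IH'
  have b2 := tailPsi_le hx0 TL (by decide) IH'
  have b3 := blkPsi_le hx0 BU (by decide) IH'
  have b4 := tailPsi_le hx0 TU (by decide) IH'
  have b5 := le_blkPsi hx0 GU (by decide) IH'
  have c1 := mul_le_mul_of_nonneg_left cBL_le hx0.le
  have c2 := mul_le_mul_of_nonneg_left cTL_le hx0.le
  have c3 := mul_le_mul_of_nonneg_left cBU_le hx0.le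
  have c4 := mul_le_mul_of_nonneg_left cTU_le hx0.le
  have c5 := mul_le_mul_of_nonneg_left le_cGU hx0.le
  have w1 := mul_le_mul_of_nonneg_right hω.1 hx0.le
  have w2 := mul_le_mul_of_nonneg_right hω.2 hx0.le
  constructor <;> linarith [hV.1, hV.2]

/-- Both bounds for `x ≥ 227`, by strong induction on `⌊x⌋` (base ranges §3, §6; step §7). [cite: CostaPereira1989, Theorem 2 / Corollary 1 (2.39), pp. 318–320] -/
private theorem psi_bounds_of_floor_eq (n : ℕ) : ∀ x : ℝ, 227 ≤ x → ⌊x⌋₊ = n →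
    0.9636 * x ≤ ψ x ∧ ψ x ≤ 1.0364 * x := by
  induction n using Nat.strong_induction_on with
  | _ n IHn =>
    intro x hx hn
    rcases lt_or_ge x 50001 with h1 | h1
    · exact ⟨psi_ge_base1 hx h1, psi_le_base1 (by linarith) h1⟩
    rcases le_or_gt x 1000000 with h2 | h2
    · exact psi_bounds_base2 (by linarith) h2
    · have IH' : ∀ y : ℝ, 227 ≤ y → y ≤ x / 17 → 0.9636 * y ≤ ψ y ∧ ψ y ≤ 1.0364 * y := by
        intro y hy hy'
        refine IHn ⌊y⌋₊ ?_ y hy rfl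
        rw [← hn]
        have h1 : (⌊y⌋₊ : ℝ) ≤ y := Nat.floor_le (by linarith)
        have h2 : x < ⌊x⌋₊ + 1 := Nat.lt_floor_add_one x
        have h3 : x / 17 ≤ x - 1 := by rw [div_le_iff₀ (by norm_num : (0:ℝ) < 17)]; linarith
        have h4 : (⌊y⌋₊ : ℝ) < ⌊x⌋₊ := by linarith
        exact_mod_cast h4
      exact step h2.le IH'

end

/-- **Costa Pereira-type lower bound `0.9636·x ≤ ψ(x)` for `x ≥ 227`**, by his `m = 17` scheme (printed for this
scheme, with the table of p. 322 and primes to `10⁵`: `ψ(x)/x > 25/26` for `x ≥ 227`, (2.41); proved here with a finer block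
design and kernel base tables, whence the stronger constant). [cite: CostaPereira1989, Theorem 2 + Corollary 1, (2.41) p. 323 (lower half; constant `0.9636 ≥ 25/26` proved here)] -/
theorem costaPereira_le_psi {x : ℝ} (hx : 227 ≤ x) : 0.9636 * x ≤ ψ x :=
  (psi_bounds_of_floor_eq ⌊x⌋₊ x hx rfl).1

/-- **Costa Pereira-type upper bound `ψ(x) ≤ 1.0364·x` for `x ≥ 201`** (printed for this scheme: `ψ(x)/x < 27/26` for
`x ≥ 114`, (2.41); here `1.0364 < 27/26` from `x ≥ 201`). [cite: CostaPereira1989, Theorem 2 + Corollary 1, (2.41) p. 323 (upper half; constant `1.0364`, range `x ≥ 201` proved here)] -/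
theorem psi_le_costaPereira {x : ℝ} (hx : 201 ≤ x) : ψ x ≤ 1.0364 * x := by
  rcases lt_or_ge x 50001 with h | h
  · exact psi_le_base1 hx h
  · exact (psi_bounds_of_floor_eq ⌊x⌋₊ x (by linarith) rfl).2

/-- **`π(n) ≥ 0.9636·n / log n` for `n ≥ 227`**, from `costaPereira_le_psi` and `ψ(x) ≤ π(x) log x`. [cite: CostaPereira1989, (2.41) p. 323 (consequence for `π`, proved here)] -/
theorem primeCounting_ge {n : ℕ} (hn : 227 ≤ n) :
    0.9636 * (n : ℝ) / Real.log n ≤ (Nat.primeCounting n : ℝ) := by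
  have hn1 : (1 : ℝ) < n := by exact_mod_cast (show 1 < n by omega)
  have hlog : 0 < Real.log n := Real.log_pos hn1
  have h1 := costaPereira_le_psi (x := n) (by exact_mod_cast hn)
  have h2 := Chebyshev.psi_le_primeCounting_mul_log n
  rw [div_le_iff₀ hlog]
  linarith

end Literature.NumberTheory.LFunctions.CostaPereira
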